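import Mathlib.MeasureTheory.Measure.Haar.Unique
import Mathlib.Topology.Algebra.Group.Quotient
import Literature.MeasureTheory.Group.HaarModularReflection
import HarnessLib

/-!
# The Weil–Bruhat invariant integral on `G/P`: densities, Bruhat functions, Weil's formula

[WeilIntegration1965] A. Weil, *L'intégration dans les groupes topologiques et ses applications* (1940, 2nd ed. 1965), §8–§9 (relatively
invariant measures, integration on homogeneous spaces); [BourbakiINT7] N. Bourbaki, *Intégration*, Chap. VII §2 n° 5–8 (quasi-invariant measures on
`G/H`, the functions `f ↦ f^♭`, Bruhat's construction).  Topic `RepresentationTheory`; namespace `Literature.RepresentationTheory.WeilBruhat`.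
GROUP-AGNOSTIC, Mathlib-level: a topological group `G` with a measure `μ` (finite on compacta, right-invariant — left-invariant too for §5's last
two theorems, i.e. `G` unimodular), a subgroup `P ≤ G` (closed where said) with a measure `ν` on `↥P` (finite on compacta, left-invariant, positive
on opens where said) and a continuous `δ : P →* ℝ≥0`.  No `sorry`; definitions + theorems only (no instance, no notation).
Cell hodgecm-mathlib, half A line LD2, plate «(S3) WEIL–BRUHAT INVARIANT INTEGRAL» of LD2-plan (g2) — the `L`-kernel «`∫_{P\U(1,1)}`» of B-p04 (g44)'s
soft road to the pin (P) of [Liu2021, Lem. D.1 (1)] (memo v3 §3); docks on `U(1,1)(L⁺_v)` by `exact`; `--supports stmt-HodgeConjecture-24832`.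

OBJECTS (§0).  `rightAverage P ν ψ x = ∫_P ψ(x p) dν(p)` (`A_P ψ`); `twistedAverage P ν δ φ x = ∫_P δ(p) φ(x p) dν(p)` (`A_P^δ φ`);
`IsDensity P δ f :↔ ∀ x p, f (x p) = δ(p)⁻¹ f x` (sections of the `δ`-density bundle of `G/P`, as functions on `G`);
`IsModularWeight P ν δ :↔ ∀ F ∈ C_c(P), ∫ δ(p) F(p⁻¹) dν = ∫ F dν` (`δ·ν` is the reflection of `ν` — the one place the modular function of `P`
enters; `δ = 1` when `ν` is inversion-invariant, `isModularWeight_one`; for a general `P` it is the classical modular function `Δ_P`, i.e. the INVERSE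
of Mathlib's `Measure.modularCharacter` of `↥P` — that identification is NOT proved here);
`IsBruhatFunction P ν η :↔ η ∈ C_c(G) ∧ A_P η = 1`; `invIntegral μ η f = ∫_G η f dμ` (`∮_{G/P} f`).
RESULTS.  §1 `A_P ψ` is right `P`-invariant, `A_P^δ φ` is a `δ`-density, `A_P^δ(η f) = A_P η · f` for a density `f`.  §2 supports / continuity of the
averages (`P` closed, `G` locally compact).  §3 **CORE** `integral_mul_twistedAverage`: `∫_G ψ · A_P^δ φ dμ = ∫_G A_P ψ · φ dμ` (`φ, ψ ∈ C_c(G)`;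
Fubini for compactly supported integrands on `G × P` — no σ-finiteness —, right-invariance of `μ`, the modular weight).  §4 **BRUHAT FUNCTIONS EXIST**
when `G/P` is compact (`exists_isBruhatFunction`: `η = φ / A_P φ` with `φ ∈ C_c(G)`, `φ = 1` on a compact `C` with `C P = G`,
`exists_isCompact_forall_eq_mul_coe`).  §5 **WEIL's FORMULA** `∮ A_P^δ φ = ∫_G φ dμ` (`invIntegral_twistedAverage`); **INDEPENDENCE** of `η`
on continuous densities (`invIntegral_eq_of_isBruhatFunction`); **LEFT `G`-INVARIANCE** `∮ f(h ·) = ∮ f` (`invIntegral_comp_mul_left`, `…_comp_inv_mul`).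
USE (→ B-p04 (g44), (J1) LD2-p02): with `G = U(1,1)(L⁺_v)` (unimodular), `P` its Borel, `f(h) = lam(ω(s′ h⁻¹) Φ)` a continuous `δ`-density for the
right `P`-eigencharacter of `lam`, `Φ ↦ ∮ f` is a `G`-invariant functional; Weil's formula evaluates it on `A_P^δ` of a test function.  HONEST LABEL:
pure measure theory, nothing of [Liu2021] asserted; HC_CM is proved only modulo the 7 printed citations (2 remaining: hLiu418 = stmt-HodgeConjecture-24832,
h413 = stmt-HodgeConjecture-24833) until rung 0 closes; count-neutral.

## References
* [WeilIntegration1965] A. Weil, *L'intégration dans les groupes topologiques et ses applications*, ASI 869/1145, Hermann (1940/1965), §8–§9.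
* [BourbakiINT7] N. Bourbaki, *Intégration, Chap. VII–VIII*, Chap. VII §2 n° 5–8.
* [BorelWallach2000] A. Borel, N. Wallach, *Continuous cohomology, discrete subgroups, and representations of reductive groups*, I §1 (densities on `P\G`).
-/

set_option autoImplicit false

noncomputable section

open MeasureTheory
open scoped NNReal Pointwise

namespace Literature.RepresentationTheory.WeilBruhat

variable {G : Type*} [Group G] [TopologicalSpace G] [IsTopologicalGroup G] [MeasurableSpace G] [BorelSpace G]
  (P : Subgroup G) (ν : Measure P) (δ : P →* ℝ≥0)

/-- the RIGHT AVERAGE over `P`: `(A_P ψ)(x) = ∫_P ψ(x p) dν(p)`. [cite: WeilIntegration1965, §9] -/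
def rightAverage (ψ : G → ℂ) (x : G) : ℂ := ∫ p, ψ (x * (p : G)) ∂ν

/-- the `δ`-TWISTED AVERAGE over `P`: `(A_P^δ φ)(x) = ∫_P δ(p) φ(x p) dν(p)`. [cite: WeilIntegration1965, §9] -/
def twistedAverage (φ : G → ℂ) (x : G) : ℂ := ∫ p, ((δ p : ℝ) : ℂ) * φ (x * (p : G)) ∂ν

/-- `δ`-DENSITIES on `G` (sections of the density bundle of `G/P`): `f (x p) = δ(p)⁻¹ f(x)` for `p ∈ P`.
[cite: WeilIntegration1965, §9] -/
def IsDensity (f : G → ℂ) : Prop := ∀ (x : G) (p : P), f (x * (p : G)) = (((δ p : ℝ) : ℂ))⁻¹ * f x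

/-- `δ` is a MODULAR WEIGHT for the left Haar measure `ν` of `P`: `∫ δ(p) F(p⁻¹) dν(p) = ∫ F dν` for `F ∈ C_c(P)` — i.e.
`δ · ν` is the reflection `ν̌` of `ν`; satisfied by the (classical) modular function of `P`. [cite: WeilIntegration1965, §8] -/
def IsModularWeight (ν : Measure P) (δ : P →* ℝ≥0) : Prop :=
  ∀ F : P → ℂ, Continuous F → HasCompactSupport F → ∫ p, ((δ p : ℝ) : ℂ) * F p⁻¹ ∂ν = ∫ p, F p ∂ν

/-- a BRUHAT FUNCTION for `(G, P, ν)`: `η ∈ C_c(G)` with `∫_P η(x p) dν(p) = 1` for every `x`. [cite: BourbakiINT7, Ch. VII §2] -/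
def IsBruhatFunction (η : G → ℂ) : Prop := Continuous η ∧ HasCompactSupport η ∧ ∀ x, rightAverage P ν η x = 1

/-- the INVARIANT INTEGRAL `∮_{G/P} f := ∫_G η f dμ` of a density `f`, computed with the Bruhat function `η`.
[cite: WeilIntegration1965, §9] -/
def invIntegral (μ : Measure G) (η f : G → ℂ) : ℂ := ∫ x, η x * f x ∂μ

/-! ## §1 Covariance of the two averages; the unimodular weight -/

/-- when `ν` is inversion-invariant (e.g. `P` unimodular with its Haar measure), `δ = 1` is a modular weight. [cite: WeilIntegration1965, §8] -/
theorem isModularWeight_one [ν.IsInvInvariant] : IsModularWeight P ν 1 := by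
  intro F _ _
  simp only [MonoidHom.one_apply, NNReal.coe_one, Complex.ofReal_one, one_mul]
  exact integral_inv_eq_self F ν


/-- `A_P ψ` is right `P`-invariant (left-invariance of `ν`). [cite: WeilIntegration1965, §9] -/
theorem rightAverage_mul_coe [ν.IsMulLeftInvariant] (ψ : G → ℂ) (x : G) (p₀ : P) :
    rightAverage P ν ψ (x * (p₀ : G)) = rightAverage P ν ψ x := by
  unfold rightAverage
  have h := integral_mul_left_eq_self (μ := ν) (fun q : P => ψ (x * (q : G))) p₀
  simp only [Subgroup.coe_mul, ← mul_assoc] at h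
  exact h

/-- `A_P^δ φ` is a `δ`-density: `(A_P^δ φ)(x p₀) = δ(p₀)⁻¹ (A_P^δ φ)(x)`. [cite: WeilIntegration1965, §9] -/
theorem isDensity_twistedAverage [ν.IsMulLeftInvariant] (φ : G → ℂ) : IsDensity P δ (twistedAverage P ν δ φ) := by
  intro x p₀
  unfold twistedAverage
  have hδ0 : ((δ p₀ : ℝ) : ℂ) ≠ 0 := by
    have h1 : δ p₀ * δ p₀⁻¹ = 1 := by rw [← map_mul, mul_inv_cancel, map_one]
    exact_mod_cast left_ne_zero_of_mul_eq_one h1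
  have h := integral_mul_left_eq_self (μ := ν) (fun q : P => ((δ q : ℝ) : ℂ) * φ (x * (q : G))) p₀
  simp only [map_mul, Subgroup.coe_mul, NNReal.coe_mul, Complex.ofReal_mul, ← mul_assoc] at h
  rw [← h, ← integral_const_mul]
  refine integral_congr_ae (Filter.Eventually.of_forall fun q => ?_)
  simp only
  rw [← mul_assoc, ← mul_assoc, inv_mul_cancel₀ hδ0, one_mul]

omit [TopologicalSpace G] [IsTopologicalGroup G] [BorelSpace G] in
/-- for a `δ`-density `f` and any `η`: `A_P^δ (η f) = (A_P η) · f`. [cite: WeilIntegration1965, §9] -/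
theorem twistedAverage_mul_of_isDensity {f : G → ℂ} (hf : IsDensity P δ f) (η : G → ℂ) (x : G) :
    twistedAverage P ν δ (fun y => η y * f y) x = rightAverage P ν η x * f x := by
  unfold twistedAverage rightAverage
  rw [← integral_mul_const]
  refine integral_congr_ae (Filter.Eventually.of_forall fun q => ?_)
  have hδ0 : ((δ q : ℝ) : ℂ) ≠ 0 := by
    have h1 : δ q * δ q⁻¹ = 1 := by rw [← map_mul, mul_inv_cancel, map_one]
    exact_mod_cast left_ne_zero_of_mul_eq_one h1
  simp only
  rw [hf x q, ← mul_assoc, ← mul_assoc, mul_comm (((δ q : ℝ) : ℂ)) (η _), mul_assoc (η _), mul_inv_cancel₀ hδ0, mul_one]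

/-! ## §2 Supports and continuity of the averages (`P` closed, `G` locally compact) -/

omit [MeasurableSpace G] [BorelSpace G] in
/-- `q ↦ ψ(x q)` is compactly supported on the CLOSED subgroup `P` when `ψ ∈ C_c(G)`. [cite: WeilIntegration1965, §9] -/
theorem hasCompactSupport_comp_mul_coe (hP : IsClosed (P : Set G)) {α : Type*} [Zero α] {ψ : G → α}
    (h'ψ : HasCompactSupport ψ) (x : G) : HasCompactSupport fun q : P => ψ (x * (q : G)) :=
  h'ψ.comp_isClosedEmbedding ((Homeomorph.mulLeft x).isClosedEmbedding.comp hP.isClosedEmbedding_subtypeVal)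

omit [MeasurableSpace G] [BorelSpace G] in
/-- the set `{q ∈ P | q ∈ closure (K⁻¹ L)}` is compact for compact `K, L ⊆ G` (`P` closed). [cite: WeilIntegration1965, §9] -/
theorem isCompact_preimage_coe_closure_inv_mul (hP : IsClosed (P : Set G)) {K L : Set G} (hK : IsCompact K)
    (hL : IsCompact L) : IsCompact (((↑) : P → G) ⁻¹' closure (K⁻¹ * L)) :=
  hP.isClosedEmbedding_subtypeVal.isCompact_preimage (hK.inv.mul hL).closure

omit [MeasurableSpace G] [BorelSpace G] in
/-- the two-variable integrand `(x, q) ↦ ψ(x) · c(q) · φ(x q)` has compact support in `G × P`. [cite: WeilIntegration1965, §9] -/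
theorem hasCompactSupport_mul_comp_mul (hP : IsClosed (P : Set G)) {φ ψ : G → ℂ} (h'φ : HasCompactSupport φ)
    (h'ψ : HasCompactSupport ψ) (c : P → ℂ) :
    HasCompactSupport (Function.uncurry fun (x : G) (q : P) => ψ x * (c q * φ (x * (q : G)))) := by
  set K := tsupport ψ
  set L := tsupport φ
  refine HasCompactSupport.intro' (h'ψ.prod (isCompact_preimage_coe_closure_inv_mul P hP h'ψ h'φ))
    ((isClosed_tsupport ψ).prod (isClosed_closure.preimage continuous_subtype_val)) ?_
  rintro ⟨x, q⟩ hxq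
  simp only [Function.uncurry_apply_pair]
  by_cases hx : x ∈ K
  · have hq : ((q : G)) ∉ closure (K⁻¹ * L) := fun h => hxq (Set.mk_mem_prod hx h)
    have hxq' : x * (q : G) ∉ L := by
      intro h
      exact hq (subset_closure (Set.mem_mul.2 ⟨x⁻¹, Set.inv_mem_inv.2 hx, x * (q : G), h, by group⟩))
    rw [image_eq_zero_of_notMem_tsupport hxq', mul_zero, mul_zero]
  · rw [image_eq_zero_of_notMem_tsupport hx, zero_mul]

omit [MeasurableSpace G] [BorelSpace G] in
/-- the two-variable integrand `(x, q) ↦ c(q) · ψ(x q⁻¹) · φ(x)` has compact support in `G × P`. [cite: WeilIntegration1965, §9] -/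
theorem hasCompactSupport_mul_comp_mul_inv (hP : IsClosed (P : Set G)) {φ ψ : G → ℂ} (h'φ : HasCompactSupport φ)
    (h'ψ : HasCompactSupport ψ) (c : P → ℂ) :
    HasCompactSupport (Function.uncurry fun (x : G) (q : P) => c q * (ψ (x * (q : G)⁻¹) * φ x)) := by
  set K := tsupport ψ
  set L := tsupport φ
  refine HasCompactSupport.intro' (h'φ.prod (isCompact_preimage_coe_closure_inv_mul P hP h'ψ h'φ))
    ((isClosed_tsupport φ).prod (isClosed_closure.preimage continuous_subtype_val)) ?_
  rintro ⟨x, q⟩ hxq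
  simp only [Function.uncurry_apply_pair]
  by_cases hx : x ∈ L
  · have hq : ((q : G)) ∉ closure (K⁻¹ * L) := fun h => hxq (Set.mk_mem_prod hx h)
    have hxq' : x * (q : G)⁻¹ ∉ K := by
      intro h
      exact hq (subset_closure (Set.mem_mul.2 ⟨(x * (q : G)⁻¹)⁻¹, Set.inv_mem_inv.2 h, x, hx, by group⟩))
    rw [image_eq_zero_of_notMem_tsupport hxq', zero_mul, mul_zero]
  · rw [image_eq_zero_of_notMem_tsupport hx, mul_zero, mul_zero]

/-- `x ↦ ∫_P c(q) φ(x q) dν(q)` is continuous for `φ ∈ C_c(G)`, `c` continuous, `ν` finite on compacta. [cite: WeilIntegration1965, §9] -/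
theorem continuous_integral_mul_comp_mul [LocallyCompactSpace G] [IsFiniteMeasureOnCompacts ν] (hP : IsClosed (P : Set G))
    {c : P → ℂ} (hc : Continuous c) {φ : G → ℂ} (hφ : Continuous φ) (h'φ : HasCompactSupport φ) :
    Continuous fun x : G => ∫ q, c q * φ (x * (q : G)) ∂ν := by
  set L := tsupport φ
  refine continuous_iff_continuousAt.2 fun x₀ => ?_
  obtain ⟨t, t_comp, ht⟩ := exists_compact_mem_nhds x₀
  have A : ContinuousOn (fun x : G => ∫ q, c q * φ (x * (q : G)) ∂ν) t := by
    apply continuousOn_integral_of_compact_support (isCompact_preimage_coe_closure_inv_mul P hP t_comp h'φ)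
    · exact ((hc.comp continuous_snd).mul
        (hφ.comp (continuous_fst.mul (continuous_subtype_val.comp continuous_snd)))).continuousOn
    · intro x q hx hq
      have hxq : x * (q : G) ∉ L := fun h =>
        hq (subset_closure (Set.mem_mul.2 ⟨x⁻¹, Set.inv_mem_inv.2 hx, x * (q : G), h, by group⟩))
      rw [image_eq_zero_of_notMem_tsupport hxq, mul_zero]
  exact A.continuousAt ht

/-- `A_P ψ` is continuous for `ψ ∈ C_c(G)`. [cite: WeilIntegration1965, §9] -/
theorem continuous_rightAverage [LocallyCompactSpace G] [IsFiniteMeasureOnCompacts ν] (hP : IsClosed (P : Set G))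
    {ψ : G → ℂ} (hψ : Continuous ψ) (h'ψ : HasCompactSupport ψ) : Continuous (rightAverage P ν ψ) := by
  have h := continuous_integral_mul_comp_mul P ν hP (c := fun _ => (1 : ℂ)) continuous_const hψ h'ψ
  simp only [one_mul] at h
  exact h

/-- `A_P^δ φ` is continuous for `φ ∈ C_c(G)` and `δ` continuous. [cite: WeilIntegration1965, §9] -/
theorem continuous_twistedAverage [LocallyCompactSpace G] [IsFiniteMeasureOnCompacts ν] (hP : IsClosed (P : Set G))
    (hδ : Continuous δ) {φ : G → ℂ} (hφ : Continuous φ) (h'φ : HasCompactSupport φ) :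
    Continuous (twistedAverage P ν δ φ) :=
  continuous_integral_mul_comp_mul P ν hP (Complex.continuous_ofReal.comp (NNReal.continuous_coe.comp hδ)) hφ h'φ

/-! ## §3 The core identity `⟨ψ, A_P^δ φ⟩_G = ⟨A_P ψ, φ⟩_G` (Fubini on `G × P`, right-invariance of `μ`, the modular weight) -/

/-- **`∫_G ψ · A_P^δ φ dμ = ∫_G A_P ψ · φ dμ`** for `φ, ψ ∈ C_c(G)`: `G` with a RIGHT-invariant `μ` finite on compacta, `P` closed with
`ν` finite on compacta, `δ` a continuous modular weight for `ν`. [cite: WeilIntegration1965, §9] -/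
theorem integral_mul_twistedAverage [LocallyCompactSpace G] (μ : Measure G) [IsFiniteMeasureOnCompacts μ]
    [μ.IsMulRightInvariant] [IsFiniteMeasureOnCompacts ν] (hP : IsClosed (P : Set G)) (hδ : Continuous δ)
    (hmod : IsModularWeight P ν δ) {φ ψ : G → ℂ} (hφ : Continuous φ) (h'φ : HasCompactSupport φ) (hψ : Continuous ψ)
    (h'ψ : HasCompactSupport ψ) :
    ∫ x, ψ x * twistedAverage P ν δ φ x ∂μ = ∫ x, rightAverage P ν ψ x * φ x ∂μ := by
  have hδc : Continuous fun p : P => ((δ p : ℝ) : ℂ) := Complex.continuous_ofReal.comp (NNReal.continuous_coe.comp hδ)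
  calc ∫ x, ψ x * twistedAverage P ν δ φ x ∂μ
      = ∫ x, ∫ q, ψ x * ((((δ q : ℝ) : ℂ)) * φ (x * (q : G))) ∂ν ∂μ := by
        simp only [twistedAverage, integral_const_mul]
    _ = ∫ q, ∫ x, ψ x * ((((δ q : ℝ) : ℂ)) * φ (x * (q : G))) ∂μ ∂ν := by
        apply integral_integral_swap_of_hasCompactSupport
        · exact (hψ.comp continuous_fst).mul
            ((hδc.comp continuous_snd).mul (hφ.comp (continuous_fst.mul (continuous_subtype_val.comp continuous_snd))))
        · exact hasCompactSupport_mul_comp_mul P hP h'φ h'ψ _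
    _ = ∫ q, ∫ x, (((δ q : ℝ) : ℂ)) * (ψ (x * (q : G)⁻¹) * φ x) ∂μ ∂ν := by
        refine integral_congr_ae (Filter.Eventually.of_forall fun q => ?_)
        have h := integral_mul_right_eq_self (μ := μ) (fun x => (((δ q : ℝ) : ℂ)) * (ψ (x * (q : G)⁻¹) * φ x)) (q : G)
        simp only [mul_inv_cancel_right] at h
        simp only
        rw [← h]
        refine integral_congr_ae (Filter.Eventually.of_forall fun x => ?_)
        simp only
        ring
    _ = ∫ x, ∫ q, (((δ q : ℝ) : ℂ)) * (ψ (x * (q : G)⁻¹) * φ x) ∂ν ∂μ := by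
        symm
        apply integral_integral_swap_of_hasCompactSupport
        · exact (hδc.comp continuous_snd).mul
            ((hψ.comp (continuous_fst.mul (continuous_subtype_val.comp continuous_snd).inv)).mul (hφ.comp continuous_fst))
        · exact hasCompactSupport_mul_comp_mul_inv P hP h'φ h'ψ _
    _ = ∫ x, (∫ q, (((δ q : ℝ) : ℂ)) * ψ (x * (q : G)⁻¹) ∂ν) * φ x ∂μ := by
        refine integral_congr_ae (Filter.Eventually.of_forall fun x => ?_)
        simp only [← mul_assoc]
        exact integral_mul_const _ _
    _ = ∫ x, rightAverage P ν ψ x * φ x ∂μ := by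
        refine integral_congr_ae (Filter.Eventually.of_forall fun x => ?_)
        have hF := hmod (fun q : P => ψ (x * (q : G))) (hψ.comp (continuous_const.mul continuous_subtype_val))
          (hasCompactSupport_comp_mul_coe P hP h'ψ x)
        simp only [Subgroup.coe_inv] at hF
        simp only [rightAverage, hF]

/-! ## §4 Bruhat functions exist when `G/P` is compact -/

omit [MeasurableSpace G] [BorelSpace G] in
/-- **a compact set of representatives**: if `G/P` is compact there is a compact `C ⊆ G` with `C · P = G`.
[cite: BourbakiINT7, Ch. VII §2] -/
theorem exists_isCompact_forall_eq_mul_coe [LocallyCompactSpace G] [CompactSpace (G ⧸ P)] :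
    ∃ C : Set G, IsCompact C ∧ ∀ x : G, ∃ c ∈ C, ∃ p : P, x = c * (p : G) := by
  classical
  choose K hKc hKn using fun g : G => exists_compact_mem_nhds g
  let U : G → Set (G ⧸ P) := fun g => QuotientGroup.mk '' interior (K g)
  have hUo : ∀ g, IsOpen (U g) := fun g => QuotientGroup.isOpenMap_coe _ isOpen_interior
  have hcover : (Set.univ : Set (G ⧸ P)) ⊆ ⋃ g, U g := by
    rintro y -
    obtain ⟨g, rfl⟩ := QuotientGroup.mk_surjective y
    exact Set.mem_iUnion.2 ⟨g, g, mem_interior_iff_mem_nhds.2 (hKn g), rfl⟩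
  obtain ⟨t, ht⟩ := isCompact_univ.elim_finite_subcover U hUo hcover
  refine ⟨⋃ g ∈ t, K g, t.isCompact_biUnion fun g _ => hKc g, fun x => ?_⟩
  obtain ⟨g, hg, hx⟩ := Set.mem_iUnion₂.1 (ht (Set.mem_univ (QuotientGroup.mk x : G ⧸ P)))
  obtain ⟨u, hu, hux⟩ := hx
  have hp : u⁻¹ * x ∈ P := QuotientGroup.eq.1 hux
  exact ⟨u, Set.mem_iUnion₂.2 ⟨g, hg, interior_subset hu⟩, ⟨u⁻¹ * x, hp⟩, by simp only [mul_inv_cancel_left]⟩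

omit [TopologicalSpace G] [IsTopologicalGroup G] [BorelSpace G] in
/-- the right average of a REAL function is real: `A_P (φ : ℂ) x = ↑(∫_P φ(x p) dν)`. [cite: WeilIntegration1965, §9] -/
theorem rightAverage_ofReal (φ : G → ℝ) (x : G) :
    rightAverage P ν (fun y => (φ y : ℂ)) x = ((∫ p, φ (x * (p : G)) ∂ν : ℝ) : ℂ) :=
  integral_ofReal

/-- **BRUHAT FUNCTIONS EXIST** on `(G, P, ν)` when `G/P` is compact, `P` is closed, and `ν` is a left-invariant measure on `P` finite on
compacta and positive on opens: there is `η ∈ C_c(G)`, `η ≥ 0`, with `∫_P η(x p) dν(p) = 1` for all `x`.  (Take `φ ∈ C_c(G)`, `0 ≤ φ`,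
`φ = 1` on a compact `C` with `C P = G`, and `η = φ / A_P φ`.) [cite: BourbakiINT7, Ch. VII §2] [cite: WeilIntegration1965, §9] -/
theorem exists_isBruhatFunction [LocallyCompactSpace G] [CompactSpace (G ⧸ P)] [IsFiniteMeasureOnCompacts ν] [ν.IsOpenPosMeasure]
    [ν.IsMulLeftInvariant] (hP : IsClosed (P : Set G)) :
    ∃ η₀ : G → ℝ, Continuous η₀ ∧ HasCompactSupport η₀ ∧ 0 ≤ η₀ ∧ IsBruhatFunction P ν fun x => (η₀ x : ℂ) := by
  obtain ⟨C, hC, hCP⟩ := exists_isCompact_forall_eq_mul_coe P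
  obtain ⟨⟨φ, hφc⟩, hφC, -, hφcs, hφ01⟩ :=
    exists_continuous_one_zero_of_isCompact hC isClosed_empty (Set.disjoint_empty C)
  simp only [ContinuousMap.coe_mk] at hφC hφcs hφ01
  -- the real average `A x = ∫_P φ(x p) dν`
  set A : G → ℝ := fun x => ∫ p, φ (x * (p : G)) ∂ν with hA
  have hAC : ∀ x, rightAverage P ν (fun y => (φ y : ℂ)) x = (A x : ℂ) := fun x => rightAverage_ofReal P ν φ x
  have hApos : ∀ x, 0 < A x := by
    intro x
    obtain ⟨c, hc, p₀, rfl⟩ := hCP x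
    refine Continuous.integral_pos_of_hasCompactSupport_nonneg_nonzero
      (hφc.comp (continuous_const.mul continuous_subtype_val)) (hasCompactSupport_comp_mul_coe P hP hφcs _)
      (fun p => (hφ01 _).1) (x := p₀⁻¹) ?_
    simp only [Subgroup.coe_inv, mul_inv_cancel_right, hφC hc, Pi.one_apply]
    exact one_ne_zero
  have hAc : Continuous A := by
    have h1 : Continuous fun x => (rightAverage P ν (fun y => (φ y : ℂ)) x).re :=
      Complex.continuous_re.comp
        (continuous_rightAverage P ν hP (Complex.continuous_ofReal.comp hφc) (hφcs.comp_left Complex.ofReal_zero))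
    simp only [hAC, Complex.ofReal_re] at h1
    exact h1
  have hAP : ∀ (x : G) (p : P), A (x * (p : G)) = A x := by
    intro x p
    have h := rightAverage_mul_coe P ν (fun y => (φ y : ℂ)) x p
    rwa [hAC, hAC, Complex.ofReal_inj] at h
  refine ⟨fun x => φ x / A x, hφc.div hAc fun x => (hApos x).ne', ?_, fun x => div_nonneg (hφ01 x).1 (hApos x).le,
    Complex.continuous_ofReal.comp (hφc.div hAc fun x => (hApos x).ne'), ?_, fun x => ?_⟩
  · exact hφcs.mono fun x hx => by
      rw [Function.mem_support] at hx ⊢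
      exact fun h => hx (by rw [h, zero_div])
  · exact (hφcs.mono fun x hx => by
      rw [Function.mem_support] at hx ⊢
      exact fun h => hx (by rw [h, zero_div])).comp_left Complex.ofReal_zero
  · rw [rightAverage_ofReal]
    have h1 : ∫ p, φ (x * (p : G)) / A (x * (p : G)) ∂ν = ∫ p, φ (x * (p : G)) / A x ∂ν :=
      integral_congr_ae (Filter.Eventually.of_forall fun p => by simp only [hAP])
    rw [h1, integral_div, div_self (hApos x).ne', Complex.ofReal_one]

/-! ## §5 The invariant integral: Weil's formula, independence of the Bruhat function, left `G`-invariance -/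

section Invariant

variable [LocallyCompactSpace G] (μ : Measure G) [IsFiniteMeasureOnCompacts μ] [μ.IsMulRightInvariant]
  [IsFiniteMeasureOnCompacts ν]

/-- **WEIL's FORMULA** `∮_{G/P} A_P^δ φ = ∫_G φ dμ` for `φ ∈ C_c(G)` (any Bruhat function `η`). [cite: WeilIntegration1965, §9] -/
theorem invIntegral_twistedAverage (hP : IsClosed (P : Set G)) (hδ : Continuous δ) (hmod : IsModularWeight P ν δ) {η : G → ℂ}
    (hη : IsBruhatFunction P ν η) {φ : G → ℂ} (hφ : Continuous φ) (h'φ : HasCompactSupport φ) :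
    invIntegral μ η (twistedAverage P ν δ φ) = ∫ x, φ x ∂μ := by
  unfold invIntegral
  rw [integral_mul_twistedAverage P ν δ μ hP hδ hmod hφ h'φ hη.1 hη.2.1]
  simp only [hη.2.2, one_mul]

/-- **THE INVARIANT INTEGRAL DOES NOT DEPEND ON THE BRUHAT FUNCTION**: `∫_G η f dμ = ∫_G η' f dμ` for a continuous `δ`-density `f`.
[cite: WeilIntegration1965, §9] [cite: BourbakiINT7, Ch. VII §2] -/
theorem invIntegral_eq_of_isBruhatFunction (hP : IsClosed (P : Set G)) (hδ : Continuous δ) (hmod : IsModularWeight P ν δ)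
    {η η' : G → ℂ} (hη : IsBruhatFunction P ν η) (hη' : IsBruhatFunction P ν η') {f : G → ℂ} (hf : Continuous f)
    (hfd : IsDensity P δ f) : invIntegral μ η f = invIntegral μ η' f := by
  have key : ∀ x, twistedAverage P ν δ (fun y => η y * f y) x = f x := fun x => by
    rw [twistedAverage_mul_of_isDensity P ν δ hfd, hη.2.2, one_mul]
  unfold invIntegral
  symm
  calc ∫ x, η' x * f x ∂μ = ∫ x, η' x * twistedAverage P ν δ (fun y => η y * f y) x ∂μ := by simp only [key]
    _ = ∫ x, rightAverage P ν η' x * (η x * f x) ∂μ :=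
        integral_mul_twistedAverage P ν δ μ hP hδ hmod (hη.1.mul hf) (hη.2.1.mul_right (f' := f)) hη'.1 hη'.2.1
    _ = ∫ x, η x * f x ∂μ := by simp only [hη'.2.2, one_mul]

omit [BorelSpace G] [LocallyCompactSpace G] [IsFiniteMeasureOnCompacts μ] [μ.IsMulRightInvariant] [IsFiniteMeasureOnCompacts ν] in
/-- left translates of Bruhat functions are Bruhat functions. [cite: BourbakiINT7, Ch. VII §2] -/
theorem isBruhatFunction_comp_mul_left {η : G → ℂ} (hη : IsBruhatFunction P ν η) (h : G) :
    IsBruhatFunction P ν fun x => η (h * x) := by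
  refine ⟨hη.1.comp (continuous_const.mul continuous_id), hη.2.1.comp_homeomorph (Homeomorph.mulLeft h), fun x => ?_⟩
  have e := hη.2.2 (h * x)
  simp only [rightAverage, mul_assoc] at e ⊢
  exact e

/-- **LEFT `G`-INVARIANCE**: `∮ f(h⁻¹ ·) = ∮ f` for a continuous `δ`-density `f` (`μ` also left-invariant, i.e. `G` unimodular).
[cite: WeilIntegration1965, §9] -/
theorem invIntegral_comp_inv_mul [μ.IsMulLeftInvariant] (hP : IsClosed (P : Set G)) (hδ : Continuous δ)
    (hmod : IsModularWeight P ν δ) {η : G → ℂ} (hη : IsBruhatFunction P ν η) {f : G → ℂ} (hf : Continuous f)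
    (hfd : IsDensity P δ f) (h : G) : invIntegral μ η (fun x => f (h⁻¹ * x)) = invIntegral μ η f := by
  calc invIntegral μ η (fun x => f (h⁻¹ * x)) = ∫ x, η (h * x) * f x ∂μ := by
        unfold invIntegral
        have e := integral_mul_left_eq_self (μ := μ) (fun x => η x * f (h⁻¹ * x)) h
        simp only [inv_mul_cancel_left] at e
        exact e.symm
    _ = invIntegral μ (fun x => η (h * x)) f := rfl
    _ = invIntegral μ η f :=
        invIntegral_eq_of_isBruhatFunction P ν δ μ hP hδ hmod (isBruhatFunction_comp_mul_left P ν hη h) hη hf hfd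

/-- **LEFT `G`-INVARIANCE** (translation form): `∮ f(h ·) = ∮ f` for a continuous `δ`-density `f`. [cite: WeilIntegration1965, §9] -/
theorem invIntegral_comp_mul_left [μ.IsMulLeftInvariant] (hP : IsClosed (P : Set G)) (hδ : Continuous δ)
    (hmod : IsModularWeight P ν δ) {η : G → ℂ} (hη : IsBruhatFunction P ν η) {f : G → ℂ} (hf : Continuous f)
    (hfd : IsDensity P δ f) (h : G) : invIntegral μ η (fun x => f (h * x)) = invIntegral μ η f := by
  have e := invIntegral_comp_inv_mul P ν δ μ hP hδ hmod hη hf hfd h⁻¹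
  simp only [inv_inv] at e
  exact e

end Invariant

/-! ## ED. 2 — the modular weight of a closed subgroup IS Mathlib's modular character (second countable case)

With ★ `Literature.MeasureTheory.Group.integral_modularCharacter_mul_comp_inv` (`(Δ·ν)̌ = ν`) the hypothesis `IsModularWeight P ν δ` of §3–§5
is discharged for `δ = Measure.modularCharacter (↥P)` whenever `↥P` is locally compact and second countable and `ν` is a Haar measure on it — so
the invariant integral of §5 needs NO modular input beyond Mathlib's.  See also ★ `Literature.MeasureTheory.Group.IsBruhatFunction` (real-valued
Bruhat functions for the INVARIANT-measure case of a possibly non-compact `G ⧸ H`); the present file is the `δ`-twisted (quasi-invariant) case. -/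

/-- **`Δ_P` (Mathlib's modular character of `↥P`) is a modular weight for every Haar measure `ν` of `↥P`** (`↥P` locally compact, second
countable, Hausdorff). [cite: Folland1995, §2.4 Prop. 2.31, (2.32)] [cite: WeilIntegration1965, §8] -/
theorem isModularWeight_modularCharacter [LocallyCompactSpace P] [SecondCountableTopology P] [T2Space P] [ν.IsHaarMeasure] :
    IsModularWeight P ν Measure.modularCharacter := fun F _ _ =>
  Literature.MeasureTheory.Group.integral_modularCharacter_mul_comp_inv ν F

/-- **THE WEIL–BRUHAT INVARIANT INTEGRAL, MODULAR INPUT DISCHARGED**: for `G` locally compact with a two-sided-invariant `μ` finite on compacta,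
`P ≤ G` closed with `↥P` locally compact second countable Hausdorff and `ν` a Haar measure on `↥P`, `η` a Bruhat function and `f` a continuous
`Δ_P`-density (`f (x p) = Δ_P(p)⁻¹ f x`, `Δ_P` = Mathlib's `modularCharacter` of `↥P`): `∮ f(h ·) = ∮ f` for all `h ∈ G`.
[cite: WeilIntegration1965, §9] [cite: BourbakiINT7, Ch. VII §2] -/
theorem invIntegral_comp_mul_left_modularCharacter [LocallyCompactSpace G] [LocallyCompactSpace P] [SecondCountableTopology P] [T2Space P]
    [ν.IsHaarMeasure] (μ : Measure G) [IsFiniteMeasureOnCompacts μ] [μ.IsMulRightInvariant] [μ.IsMulLeftInvariant]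
    (hP : IsClosed (P : Set G)) (hΔ : Continuous (Measure.modularCharacter : P → ℝ≥0)) {η : G → ℂ} (hη : IsBruhatFunction P ν η)
    {f : G → ℂ} (hf : Continuous f) (hfd : IsDensity P Measure.modularCharacter f) (h : G) :
    invIntegral μ η (fun x => f (h * x)) = invIntegral μ η f :=
  invIntegral_comp_mul_left P ν Measure.modularCharacter μ hP hΔ (isModularWeight_modularCharacter P ν) hη hf hfd h

end Literature.RepresentationTheory.WeilBruhat

end
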